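import Summits.QuantumFields.BalabanUV.Beta.FP.StepLawWardGeneric
import Summits.QuantumFields.BalabanUV.Beta.FP.SymmetryLimit

/-!
# `BalabanUV.Beta.FP.SymmetryInheritGeneric` — road «FP» for binder row D1, «D1-FP-SYMM-INHERIT-GENERIC»: the FOUR-FAMILY (`TGenOf`) twin of
# leaf-06-g2's `FP/SymmetryInherit` §3 — the sockets `hWf` (Ward row), hR∞ (axis reflection) and `hTsymm` (transposition) of the owner's
# STEP-GENERIC END at the perfect `m = 1` triple FROM THE FINITE-`j` ROWS of ANY wall family with a four-family closed form, under EXACTLY the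
# Cauchy-currency binders of `RoadEndGeneric.d1Drift_of_generic_step_law_bounded`; and the END with `hWf ↦ hWj`, `hTsymm ↦` finite-`j` swap row

HONEST DEPENDENCY (page 1, mandatory): continuum YM on T⁴ ⇐ BetaPertH ∧ nine spine estimates (0/9 proved); BetaPertH ⇐ (D1) ∧ (D4) ∧
CAP+tail; G-an2-4 gates asym, D1 and NE2/3/4.  HONEST FRAMING (cell contract, verbatim): «discharging `BetaPertH` makes Bałaban's UV
stability UNCONDITIONAL — a real constructive-QFT result; it is NOT the continuum limit and NOT the Clay problem.»  [folklore] composition BY NAME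
of leaf-06-g2's `FP/SymmetryLimit` (symmetries pass to entrywise limits), asym1's `HessKerFourFamily.geometricRate_hessKer_four_lim` + `LimitRate.GeometricRate.tendsto_apply`
(the four-slot kernels converge entrywise under the Cauchy rows), an2's `HessKerDressedLimit` closure lemmas, and the road FP owner's `RoadEndGeneric` ∕
`StepLawWardGeneric` (d1-p3-g3, R-FP-13).  No definition, no `def … : Prop`, nothing cited, 0 sorry; every row ∕ symmetry is a HYPOTHESIS; no perfect
object is identified with anything; 0∕4 binders of row D1; NOT hW, NOT hR, NOT D1, NOT BetaPertH, NOT continuum, NOT Clay.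
ABSOLUTE RULE (cell charter, verbatim): «No internally-minted statement may enter as a cited fact. Every hypothesis is either kernel-proved in this
package or a verbatim quotation of a PUBLISHED theorem with page reference. The manuscript(s) under audit are NOT citable for their own disputed
steps — they are the thing under adjudication; programme-internal (2001/route/tribunal) claims are never citable.»

WHY.  After the row-D1 owner's decision X-an2-51 the literal of record is the recursive `JsRowD1` (an1's TRUE tables), for which K-Q
`RowD1JointEnd.symmetries_JsRowD1_of_letters` yields hW ∧ hR AT EVERY FINITE `j` from the letters.  The road FP owner's dressing-agnostic END
(`StepLawWardGeneric.d1Drift_of_generic_ward_symm_explicitDefect`, p224345) asks for the symmetries AT THE PERFECT TRIPLE: `hWf`, `hTsymm`.  Two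
suppliers: (i) the LETTERS at the limit (R-FP-13 (c); leaf-01-g6 `FP/LetterInheritanceEnd` p224402 — needs rate data for every letter datum); (ii) THE
ROWS at finite `j` + entrywise convergence of the kernels — needs NOTHING beyond the END's own Cauchy rows.  leaf-06-g2's `SymmetryInherit` §3 is (ii)
for the comb family `JsBalOf` only; THIS FILE is (ii) for ANY `Js` with a four-family closed form (block-mean rooted, recursive, comb, DIRECT).

CONTENT (all [folklore]).
* §1 `swap_of_tendsto` — the transposition symmetry `T a b t = T b a (−t)` passes to entrywise limits (any `EKer D`).
* §2 (`d = 3`; binders `hsf hsm hT hA1 hG1 hS1 hW1 hA hAall hK hKall hS hSall hW hWall hR hRK hRS hRW hθ0 hθ1` = the END's, VERBATIM):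
  **`tendsto_TbalOf_TGenOf_one_of_cauchy`** — `TbalOf Lc Js j μ ν x → TGenOf Lc (KPerfOf sf sm A 1) (KPerfOf sf sm G 1) (SPerfOf sf sm S 1) (WPerfOf sf sm Wt 1) μ ν x`;
  **`wardTransversal_flipK_TGenOf_one_of_wardRow`** (`hWj : ∀ j, WardTransversal (flipK (TbalOf Lc Js j))` ⟹ the END's `hWf`);
  **`axisReflectionCovariant_flipK_TGenOf_one_of_reflRow`** (hR row ⟹ hR∞); **`swap_TGenOf_one_of_swapRow`** (finite-`j` transposition symmetry ⟹ `hTsymm`).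
* §3 **`d1Drift_of_generic_wardRow_swapRow_explicitDefect`** — the owner's END with `hWf ↦ hWj`, `hTsymm ↦ hTj`: residual {rows, class data, the two
  finite-`j` SYMMETRY ROWS of the wall family, hSDF, hasym}.
NOT HERE: any row (hypotheses); the closed form and rows for `JsRowD1` (BM-ROWS ∕ BM-PINS-type suppliers, gan24 seats); hW∕hR at finite `j` (K-Q BY NAME,
modulo an1's letters); `hTsymm` at finite `j` (or use the owner's covariance route `PerfectKernelSymmGeneric.hTsymm_TGenOf_one` instead).
Unit `b2b-balaban-beta-d1-formalise-leaf-01` (gen 6), 2026-08-20; claim table `HOME/b2b-balaban-beta-d1-p3/LEAVES-FP.md` (sub-row SYMM-INHERIT-GENERIC).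
-/

noncomputable section

namespace Summit.QuantumFields.BalabanUV.Beta.FP.SymmetryInheritGeneric

open Filter Topology
open Literature.MathematicalPhysics.QuantumFieldTheory.Balaban1983to89
open Literature.MathematicalPhysics.QuantumFieldTheory.Balaban1983to89.Beta
open B12Beta (secondMoment)
open B12Normalization (stepBal)
open DressedMomentNormalisation (EKer dressedEntry)
open ExpKernelCalculus (MKer Decays VertexFamily₂ hessKer)
open PolarizationSign (WardTransversal AxisReflectionCovariant)
open OneStepResolventKernel (Fib LocStencil JetData)
open OneStepKernelFamily (vertexOfK TbalOf flipK D1Drift)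
open HessKerDressedLimit (limMKerOf limStOf limTabOf decays_limMKerOf decays_sub_limMKerOf locStencil_limStOf locStencil_sub_limStOf
  vertexFamily₂_limTabOf vertexFamily₂_sub_limTabOf)
open Summit.QuantumFields.BalabanUV.Beta.HessKerDressedUnits (unitK unitS unitW)
open Summit.QuantumFields.BalabanUV.Beta.HessKerFourFamily (geometricRate_hessKer_four_lim)
open Summit.QuantumFields.BalabanUV.Beta.GAN24.CombesThomas (sfStep smStep)
open Summit.QuantumFields.BalabanUV.Beta.FP.PerfectObjectsT (KPerf SPerfOf WPerfOf SPerfOf_one WPerfOf_one)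
open Summit.QuantumFields.BalabanUV.Beta.FP.TransportInfinityM (colOf)
open Summit.QuantumFields.BalabanUV.Beta.FP.StepDefectInherit (defect)
open Summit.QuantumFields.BalabanUV.Beta.FP.RoadEndGeneric (KPerfOf KPerfOf_one TGenOf fPerfG closedForm_unit d1Drift_of_generic_step_law_bounded)
open Summit.QuantumFields.BalabanUV.Beta.FP.StepLawWardGeneric (fPerfG_succ_of_ward_symm_explicitDefect)
open Summit.QuantumFields.BalabanUV.Beta.FP.SymmetryLimit (wardTransversal_flipK_of_tendsto axisReflectionCovariant_flipK_of_tendsto)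

/-! ## §1 Transposition symmetry passes to entrywise limits -/

/-- [folklore] **THE TRANSPOSITION (HESSIAN) SYMMETRY `T a b t = T b a (−t)` PASSES TO ENTRYWISE LIMITS.** -/
theorem swap_of_tendsto {D : ℕ} {T : ℕ → EKer D} {Tinf : EKer D}
    (hT : ∀ j a b t, T j a b t = T j b a (-t)) (hlim : ∀ a b t, Tendsto (fun j => T j a b t) atTop (𝓝 (Tinf a b t))) (a b : Fin D)
    (t : Fin D → ℤ) : Tinf a b t = Tinf b a (-t) := by
  have h2 : Tendsto (fun j => T j a b t) atTop (𝓝 (Tinf b a (-t))) := by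
    have e : (fun j => T j a b t) = fun j => T j b a (-t) := funext fun j => hT j a b t
    rw [e]; exact hlim b a (-t)
  exact tendsto_nhds_unique (hlim a b t) h2

/-! ## §2 The wall's kernels converge entrywise to the four-slot perfect kernel; the symmetry ROWS pass to the perfect triple -/

section Inherit

variable {Lc : ℕ} [NeZero Lc] (Js : ℕ → JetData 3 Lc) (sf sm : ℕ → ℝ) (A G : ℕ → ℕ → MKer (3 + 1) (Fib 3))
  (S : ℕ → ℕ → Fin (3 + 1) → (Fin (3 + 1) → ℤ) → MKer (3 + 1) (Fib 3))
  (Wt : ℕ → ℕ → Fin (3 + 1) → (Fin (3 + 1) → ℤ) → Fin (3 + 1) → (Fin (3 + 1) → ℤ) → MKer (3 + 1) (Fib 3))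
  {A1 G1 : ℕ → MKer (3 + 1) (Fib 3)} {S1 : ℕ → Fin (3 + 1) → (Fin (3 + 1) → ℤ) → MKer (3 + 1) (Fib 3)}
  {W1 : ℕ → Fin (3 + 1) → (Fin (3 + 1) → ℤ) → Fin (3 + 1) → (Fin (3 + 1) → ℤ) → MKer (3 + 1) (Fib 3)}
  {R CA cA C cK δK Cs cS δS Cw cW δW θ : ℝ}

/-- [folklore] **THE WALL'S KERNELS CONVERGE ENTRYWISE TO THE FOUR-SLOT PERFECT KERNEL AT `m = 1`**, Cauchy currency: for ANY step jet data `Js`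
with a four-family closed form `hT`, (j, m)-families with those `m = 1` members, nonzero units, and the Cauchy rows of the END on the four unit-rescaled
`m = 1` families (`0 ≤ θ < 1`): `TbalOf Lc Js j μ ν x → TGenOf Lc (KPerfOf sf sm A 1) (KPerfOf sf sm G 1) (SPerfOf sf sm S 1) (WPerfOf sf sm Wt 1) μ ν x` —
the limits being the CONSTRUCTED ones. -/
theorem tendsto_TbalOf_TGenOf_one_of_cauchy (hsf : ∀ j, sf j ≠ 0) (hsm : ∀ j, sm j ≠ 0)
    (hT : ∀ j, TbalOf Lc Js j = hessKer (A1 j) (vertexOfK (G1 j) Lc (S1 j)) (W1 j))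
    (hA1 : ∀ j, A j 1 = A1 j) (hG1 : ∀ j, G j 1 = G1 j) (hS1 : ∀ j, S j 1 = S1 j) (hW1 : ∀ j, Wt j 1 = W1 j)
    (hA : ∀ j, Decays (unitK (sf j) (sm j) (A1 j)) CA δK)
    (hAall : ∀ k j, Decays (unitK (sf (k + j)) (sm (k + j)) (A1 (k + j)) - unitK (sf k) (sm k) (A1 k)) (cA * θ ^ k) δK)
    (hK : ∀ j, Decays (unitK (sf j) (sm j) (G1 j)) C δK)
    (hKall : ∀ k j, Decays (unitK (sf (k + j)) (sm (k + j)) (G1 (k + j)) - unitK (sf k) (sm k) (G1 k)) (cK * θ ^ k) δK)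
    (hS : ∀ j, LocStencil (unitS (sf j) (sm j) (S1 j)) Cs δS)
    (hSall : ∀ k j, LocStencil (unitS (sf (k + j)) (sm (k + j)) (S1 (k + j)) - unitS (sf k) (sm k) (S1 k)) (cS * θ ^ k) δS)
    (hW : ∀ j, VertexFamily₂ (unitW (sf j) (sm j) (W1 j)) Lc Cw δW)
    (hWall : ∀ k j, VertexFamily₂ (unitW (sf (k + j)) (sm (k + j)) (W1 (k + j)) - unitW (sf k) (sm k) (W1 k)) Lc (cW * θ ^ k) δW)
    (hR : 0 < R) (hRK : R < δK) (hRS : R / 2 < δS) (hRW : R < δW) (hθ0 : 0 ≤ θ) (hθ1 : θ < 1) (μ ν : Fin 4) (x : Fin 4 → ℤ) :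
    Tendsto (fun j => TbalOf Lc Js j μ ν x) atTop
      (𝓝 (TGenOf Lc (KPerfOf sf sm A 1) (KPerfOf sf sm G 1) (SPerfOf sf sm S 1) (WPerfOf sf sm Wt 1) μ ν x)) := by
  rw [TGenOf, KPerfOf_one sf sm hA1, KPerfOf_one sf sm hG1, SPerfOf_one sf sm hS1, WPerfOf_one sf sm hW1]
  have h := (geometricRate_hessKer_four_lim (N := Lc)
    (A := fun j => unitK (sf j) (sm j) (A1 j)) (K := fun j => unitK (sf j) (sm j) (G1 j))
    (S := fun j => unitS (sf j) (sm j) (S1 j)) (W := fun j => unitW (sf j) (sm j) (W1 j))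
    hA (decays_limMKerOf hA hAall hθ1) (decays_sub_limMKerOf hAall hθ1)
    hK (decays_limMKerOf hK hKall hθ1) (decays_sub_limMKerOf hKall hθ1)
    hS (locStencil_limStOf hS hSall hθ1) (locStencil_sub_limStOf hSall hθ1)
    hW (vertexFamily₂_limTabOf hW hWall hθ1) (vertexFamily₂_sub_limTabOf hWall hθ1) hR hRK hRS hRW μ ν).tendsto_apply hθ0 hθ1 x
  refine h.congr fun j => ?_
  show hessKer (unitK (sf j) (sm j) (A1 j)) (vertexOfK (unitK (sf j) (sm j) (G1 j)) Lc (unitS (sf j) (sm j) (S1 j)))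
      (unitW (sf j) (sm j) (W1 j)) μ ν x = TbalOf Lc Js j μ ν x
  rw [closedForm_unit Js sf sm hsf hsm hT j]

/-- [folklore] **`hWf` FROM THE WALL'S WARD ROW** (`hWj`): Ward transversality of the flipped wall kernels at EVERY `j` + the END's Cauchy rows ⟹
Ward transversality of the flipped four-slot PERFECT kernel — the socket `hWf` of `StepLawWardGeneric.fPerfG_succ_of_ward_symm_explicitDefect`
(leaf-06-g2's `SymmetryLimit.wardTransversal_flipK_of_tendsto` + `tendsto_TbalOf_TGenOf_one_of_cauchy`). -/
theorem wardTransversal_flipK_TGenOf_one_of_wardRow (hsf : ∀ j, sf j ≠ 0) (hsm : ∀ j, sm j ≠ 0)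
    (hT : ∀ j, TbalOf Lc Js j = hessKer (A1 j) (vertexOfK (G1 j) Lc (S1 j)) (W1 j))
    (hA1 : ∀ j, A j 1 = A1 j) (hG1 : ∀ j, G j 1 = G1 j) (hS1 : ∀ j, S j 1 = S1 j) (hW1 : ∀ j, Wt j 1 = W1 j)
    (hA : ∀ j, Decays (unitK (sf j) (sm j) (A1 j)) CA δK)
    (hAall : ∀ k j, Decays (unitK (sf (k + j)) (sm (k + j)) (A1 (k + j)) - unitK (sf k) (sm k) (A1 k)) (cA * θ ^ k) δK)
    (hK : ∀ j, Decays (unitK (sf j) (sm j) (G1 j)) C δK)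
    (hKall : ∀ k j, Decays (unitK (sf (k + j)) (sm (k + j)) (G1 (k + j)) - unitK (sf k) (sm k) (G1 k)) (cK * θ ^ k) δK)
    (hS : ∀ j, LocStencil (unitS (sf j) (sm j) (S1 j)) Cs δS)
    (hSall : ∀ k j, LocStencil (unitS (sf (k + j)) (sm (k + j)) (S1 (k + j)) - unitS (sf k) (sm k) (S1 k)) (cS * θ ^ k) δS)
    (hW : ∀ j, VertexFamily₂ (unitW (sf j) (sm j) (W1 j)) Lc Cw δW)
    (hWall : ∀ k j, VertexFamily₂ (unitW (sf (k + j)) (sm (k + j)) (W1 (k + j)) - unitW (sf k) (sm k) (W1 k)) Lc (cW * θ ^ k) δW)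
    (hR : 0 < R) (hRK : R < δK) (hRS : R / 2 < δS) (hRW : R < δW) (hθ0 : 0 ≤ θ) (hθ1 : θ < 1)
    (hWj : ∀ j, WardTransversal (flipK (TbalOf Lc Js j))) :
    WardTransversal (flipK (TGenOf Lc (KPerfOf sf sm A 1) (KPerfOf sf sm G 1) (SPerfOf sf sm S 1) (WPerfOf sf sm Wt 1))) :=
  wardTransversal_flipK_of_tendsto hWj fun μ ν x =>
    tendsto_TbalOf_TGenOf_one_of_cauchy Js sf sm A G S Wt hsf hsm hT hA1 hG1 hS1 hW1 hA hAall hK hKall hS hSall hW hWall hR hRK hRS hRW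
      hθ0 hθ1 μ ν x

/-- [folklore] **hR∞ FROM THE WALL'S REFLECTION ROW**: axis-reflection covariance of the flipped wall kernels at EVERY `j` + the END's Cauchy rows ⟹
axis-reflection covariance of the flipped four-slot PERFECT kernel. -/
theorem axisReflectionCovariant_flipK_TGenOf_one_of_reflRow (hsf : ∀ j, sf j ≠ 0) (hsm : ∀ j, sm j ≠ 0)
    (hT : ∀ j, TbalOf Lc Js j = hessKer (A1 j) (vertexOfK (G1 j) Lc (S1 j)) (W1 j))
    (hA1 : ∀ j, A j 1 = A1 j) (hG1 : ∀ j, G j 1 = G1 j) (hS1 : ∀ j, S j 1 = S1 j) (hW1 : ∀ j, Wt j 1 = W1 j)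
    (hA : ∀ j, Decays (unitK (sf j) (sm j) (A1 j)) CA δK)
    (hAall : ∀ k j, Decays (unitK (sf (k + j)) (sm (k + j)) (A1 (k + j)) - unitK (sf k) (sm k) (A1 k)) (cA * θ ^ k) δK)
    (hK : ∀ j, Decays (unitK (sf j) (sm j) (G1 j)) C δK)
    (hKall : ∀ k j, Decays (unitK (sf (k + j)) (sm (k + j)) (G1 (k + j)) - unitK (sf k) (sm k) (G1 k)) (cK * θ ^ k) δK)
    (hS : ∀ j, LocStencil (unitS (sf j) (sm j) (S1 j)) Cs δS)
    (hSall : ∀ k j, LocStencil (unitS (sf (k + j)) (sm (k + j)) (S1 (k + j)) - unitS (sf k) (sm k) (S1 k)) (cS * θ ^ k) δS)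
    (hW : ∀ j, VertexFamily₂ (unitW (sf j) (sm j) (W1 j)) Lc Cw δW)
    (hWall : ∀ k j, VertexFamily₂ (unitW (sf (k + j)) (sm (k + j)) (W1 (k + j)) - unitW (sf k) (sm k) (W1 k)) Lc (cW * θ ^ k) δW)
    (hR : 0 < R) (hRK : R < δK) (hRS : R / 2 < δS) (hRW : R < δW) (hθ0 : 0 ≤ θ) (hθ1 : θ < 1)
    (hRj : ∀ j, AxisReflectionCovariant (flipK (TbalOf Lc Js j))) :
    AxisReflectionCovariant (flipK (TGenOf Lc (KPerfOf sf sm A 1) (KPerfOf sf sm G 1) (SPerfOf sf sm S 1) (WPerfOf sf sm Wt 1))) :=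
  axisReflectionCovariant_flipK_of_tendsto hRj fun μ ν x =>
    tendsto_TbalOf_TGenOf_one_of_cauchy Js sf sm A G S Wt hsf hsm hT hA1 hG1 hS1 hW1 hA hAall hK hKall hS hSall hW hWall hR hRK hRS hRW
      hθ0 hθ1 μ ν x

/-- [folklore] **`hTsymm` FROM THE WALL'S TRANSPOSITION ROW**: `TbalOf Lc Js j a b t = TbalOf Lc Js j b a (−t)` at EVERY `j` + the END's Cauchy rows ⟹
the same for the four-slot PERFECT kernel — the socket `hTsymm` of the END (alternative to the covariance route `PerfectKernelSymmGeneric.hTsymm_TGenOf_one`). -/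
theorem swap_TGenOf_one_of_swapRow (hsf : ∀ j, sf j ≠ 0) (hsm : ∀ j, sm j ≠ 0)
    (hT : ∀ j, TbalOf Lc Js j = hessKer (A1 j) (vertexOfK (G1 j) Lc (S1 j)) (W1 j))
    (hA1 : ∀ j, A j 1 = A1 j) (hG1 : ∀ j, G j 1 = G1 j) (hS1 : ∀ j, S j 1 = S1 j) (hW1 : ∀ j, Wt j 1 = W1 j)
    (hA : ∀ j, Decays (unitK (sf j) (sm j) (A1 j)) CA δK)
    (hAall : ∀ k j, Decays (unitK (sf (k + j)) (sm (k + j)) (A1 (k + j)) - unitK (sf k) (sm k) (A1 k)) (cA * θ ^ k) δK)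
    (hK : ∀ j, Decays (unitK (sf j) (sm j) (G1 j)) C δK)
    (hKall : ∀ k j, Decays (unitK (sf (k + j)) (sm (k + j)) (G1 (k + j)) - unitK (sf k) (sm k) (G1 k)) (cK * θ ^ k) δK)
    (hS : ∀ j, LocStencil (unitS (sf j) (sm j) (S1 j)) Cs δS)
    (hSall : ∀ k j, LocStencil (unitS (sf (k + j)) (sm (k + j)) (S1 (k + j)) - unitS (sf k) (sm k) (S1 k)) (cS * θ ^ k) δS)
    (hW : ∀ j, VertexFamily₂ (unitW (sf j) (sm j) (W1 j)) Lc Cw δW)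
    (hWall : ∀ k j, VertexFamily₂ (unitW (sf (k + j)) (sm (k + j)) (W1 (k + j)) - unitW (sf k) (sm k) (W1 k)) Lc (cW * θ ^ k) δW)
    (hR : 0 < R) (hRK : R < δK) (hRS : R / 2 < δS) (hRW : R < δW) (hθ0 : 0 ≤ θ) (hθ1 : θ < 1)
    (hTj : ∀ j a b t, TbalOf Lc Js j a b t = TbalOf Lc Js j b a (-t)) (a b : Fin 4) (t : Fin 4 → ℤ) :
    TGenOf Lc (KPerfOf sf sm A 1) (KPerfOf sf sm G 1) (SPerfOf sf sm S 1) (WPerfOf sf sm Wt 1) a b t =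
      TGenOf Lc (KPerfOf sf sm A 1) (KPerfOf sf sm G 1) (SPerfOf sf sm S 1) (WPerfOf sf sm Wt 1) b a (-t) :=
  swap_of_tendsto hTj (fun a b t =>
    tendsto_TbalOf_TGenOf_one_of_cauchy Js sf sm A G S Wt hsf hsm hT hA1 hG1 hS1 hW1 hA hAall hK hKall hS hSall hW hWall hR hRK hRS hRW
      hθ0 hθ1 a b t) a b t

/-! ## §3 Road FP's END in generic shape with the two symmetry sockets fed by the wall's finite-`j` ROWS -/

/-- **ROAD «FP», THE END IN GENERIC SHAPE FROM THE WALL's SYMMETRY ROWS** (`d = 3`, `2 ≤ Lc`; bounded-defect form): the owner's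
`StepLawWardGeneric.d1Drift_of_generic_ward_symm_explicitDefect` with `hWf ↦ hWj` (Ward transversality of the flipped wall kernels at every `j`)
and `hTsymm ↦ hTj` (their transposition symmetry at every `j`).  RESIDUAL: {closed form + `m = 1` names; Cauchy rows (`m = 1`); class data (`m ≥ 1`);
**hWj**; **hTj**; hSDF; hasym}.  For the literal of record `JsRowD1`, `hWj` is K-Q's `symmetries_JsRowD1_of_letters` (Ward half) BY NAME — not
supplied here.  NOT «D1 closed». [our object] -/
theorem d1Drift_of_generic_wardRow_swapRow_explicitDefect (hLc2 : 2 ≤ Lc) (hsf : ∀ j, sf j ≠ 0) (hsm : ∀ j, sm j ≠ 0)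
    (hT : ∀ j, TbalOf Lc Js j = hessKer (A1 j) (vertexOfK (G1 j) Lc (S1 j)) (W1 j))
    (hA1 : ∀ j, A j 1 = A1 j) (hG1 : ∀ j, G j 1 = G1 j) (hS1 : ∀ j, S j 1 = S1 j) (hW1 : ∀ j, Wt j 1 = W1 j)
    (hA : ∀ j, Decays (unitK (sf j) (sm j) (A1 j)) CA δK)
    (hAall : ∀ k j, Decays (unitK (sf (k + j)) (sm (k + j)) (A1 (k + j)) - unitK (sf k) (sm k) (A1 k)) (cA * θ ^ k) δK)
    (hK : ∀ j, Decays (unitK (sf j) (sm j) (G1 j)) C δK)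
    (hKall : ∀ k j, Decays (unitK (sf (k + j)) (sm (k + j)) (G1 (k + j)) - unitK (sf k) (sm k) (G1 k)) (cK * θ ^ k) δK)
    (hS : ∀ j, LocStencil (unitS (sf j) (sm j) (S1 j)) Cs δS)
    (hSall : ∀ k j, LocStencil (unitS (sf (k + j)) (sm (k + j)) (S1 (k + j)) - unitS (sf k) (sm k) (S1 k)) (cS * θ ^ k) δS)
    (hW : ∀ j, VertexFamily₂ (unitW (sf j) (sm j) (W1 j)) Lc Cw δW)
    (hWall : ∀ k j, VertexFamily₂ (unitW (sf (k + j)) (sm (k + j)) (W1 (k + j)) - unitW (sf k) (sm k) (W1 k)) Lc (cW * θ ^ k) δW)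
    (hR : 0 < R) (hRK : R < δK) (hRS : R / 2 < δS) (hRW : R < δW) (hθ0 : 0 ≤ θ) (hθ1 : θ < 1)
    (hAinf : ∀ m : ℕ, 1 ≤ m → ∃ δ C : ℝ, 0 < δ ∧ 0 ≤ C ∧ Decays (KPerfOf (d := 3) sf sm A m) C δ)
    (hGinf : ∀ m : ℕ, 1 ≤ m → ∃ δ C : ℝ, 0 < δ ∧ 0 ≤ C ∧ Decays (KPerfOf (d := 3) sf sm G m) C δ)
    (hSinf : ∀ m : ℕ, 1 ≤ m → ∃ Cs δS : ℝ, 0 < δS ∧ LocStencil (SPerfOf sf sm S m) Cs δS)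
    (hWinf : ∀ m : ℕ, 1 ≤ m → ∃ Cw δW : ℝ, 0 < δW ∧ VertexFamily₂ (WPerfOf sf sm Wt m) (Lc ^ m) Cw δW)
    -- the two SYMMETRY ROWS of the wall family (finite `j`)
    (hWj : ∀ j, WardTransversal (flipK (TbalOf Lc Js j)))
    (hTj : ∀ j a b t, TbalOf Lc Js j a b t = TbalOf Lc Js j b a (-t))
    (μ ν : Fin 4)
    (hSDF : ∀ m : ℕ, 1 ≤ m → secondMoment (defect
      (fun m => TGenOf (Lc ^ m) (KPerfOf sf sm A m) (KPerfOf sf sm G m) (SPerfOf sf sm S m) (WPerfOf sf sm Wt m))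
      (fun m a b z => ((Lc ^ m : ℕ) : ℝ) ^ 8 * dressedEntry (colOf (KPerf (d := 3) Lc (sfStep Lc) (smStep 3 Lc) m))
        (TGenOf Lc (KPerfOf sf sm A 1) (KPerfOf sf sm G 1) (SPerfOf sf sm S 1) (WPerfOf sf sm Wt 1))
        (((Lc ^ m : ℕ) : ℤ) • z) a b) m) μ ν = 0)
    {N Cg : ℝ} (hasym : ∀ m : ℕ, 1 ≤ m → |fPerfG Lc sf sm A G S Wt μ ν m - (m : ℝ) * stepBal N Lc| ≤ Cg) :
    D1Drift Lc Js N μ ν :=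
  d1Drift_of_generic_step_law_bounded Js sf sm A G S Wt hsf hsm hT hA1 hG1 hS1 hW1 hA hAall hK hKall hS hSall hW hWall hR hRK hRS hRW
    hθ0 hθ1 μ ν
    (fPerfG_succ_of_ward_symm_explicitDefect sf sm A G S Wt hLc2 hAinf hGinf hSinf hWinf
      (wardTransversal_flipK_TGenOf_one_of_wardRow Js sf sm A G S Wt hsf hsm hT hA1 hG1 hS1 hW1 hA hAall hK hKall hS hSall hW hWall hR hRK
        hRS hRW hθ0 hθ1 hWj)
      (swap_TGenOf_one_of_swapRow Js sf sm A G S Wt hsf hsm hT hA1 hG1 hS1 hW1 hA hAall hK hKall hS hSall hW hWall hR hRK hRS hRW hθ0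
        hθ1 hTj)
      μ ν hSDF)
    hasym

end Inherit

end Summit.QuantumFields.BalabanUV.Beta.FP.SymmetryInheritGeneric

end
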